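import Mathlib.Algebra.CharP.Lemmas
import Mathlib.Algebra.Module.ZMod
import Mathlib.FieldTheory.Finite.GaloisField
import Mathlib.LinearAlgebra.FiniteDimensional.Lemmas
import Mathlib.LinearAlgebra.Isomorphisms
import Mathlib.LinearAlgebra.Quotient.Card
import Mathlib.Algebra.Polynomial.AlgebraMap
import HarnessLib

/-!
# The small-rank lemma: `[M : ν_j(Y) + pM] < p^{p^j - 1}` forces `ν_j(Y) ⊆ pM`
# (the module algebra of a ONE-LAYER criterion for `μ = 0`; proved)

`Proofs`-style file (theorems only: no definition, no named fact, no `sorry`) in topic `NumberTheory/IwasawaTheory`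
(namespace `Literature.NumberTheory.IwasawaTheory.FukudaSmallRank`), written by the literature seat `bsd-potss-conjA-anchor` g20
(cell `bsd-potss`; serves the asides stmt-BirchSwinnertonDyer-19386 / 19413 and the `μ`-roads of the record lanes; closes nothing).
Sibling `ClassGroupPRankSmallRankCriterion` turns it, through the cell's finite-level package of Fukuda's theorem
(`Fukuda1994Thm1RankPackage.exists_layer_package`, `FukudaGroupLayers`), into: **if a `ℤ_p`-extension is totally ramified above
`p` from layer `n`, and `rank_p Cl(K_{n+j}) < p^j - 1` for ONE `j`, then `rank_p Cl(K_{n+k}) ≤ rank_p Cl(K_{n+j})` for EVERY `k`**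
(bounded `p`-ranks, hence `μ = 0` and, through the cell's doors, Coates–Sujatha's (A)).

THE LEMMA (`map_geom_sum_le_of_card_quotient_lt`).  `M` a finite abelian group, `φ ∈ End(M)` with `φ^{p^t} = 1`, `Y ≤ M`,
`ν_j = ∑_{i<p^j} φ^i`, `pM` the multiples of `p`.  If `#(M/(ν_j Y + pM)) < p^{p^j - 1}` then `ν_j Y ⊆ pM`.
Proof.  On `M̄ = M/pM` (an `𝔽_p`-vector space) `T = φ̄ - 1` is nilpotent (`T^{p^t} = φ̄^{p^t} - 1 = 0`, Frobenius) and
`ν̄_j = ∑_{i<p^j} (1+T)^i = T^{p^j-1}` (the identity `X · ∑_{i<p^j}(1+X)^i = (1+X)^{p^j} - 1 = X^{p^j}` in `𝔽_p[X]`).  For a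
nilpotent `T` with `T^c ≠ 0` the chain `M̄ ⊋ TM̄ ⊋ ⋯ ⊋ T^cM̄` is strict, so `dim M̄/T^cM̄ ≥ c` (§1); as `ν̄_jȲ ⊆ T^cM̄`
(`c = p^j - 1`), `#(M/(ν_jY + pM)) = #(M̄/ν̄_jȲ) ≥ #(M̄/T^cM̄) ≥ p^c` unless `T^c = 0` — and then `ν̄_jȲ = T^cȲ = 0`.
This is the module-theoretic shadow of «`μ(X) > 0 ⟹ X/pX` has a free `𝔽_p⟦T⟧`-summand ⟹ `rank_p A_n ≥ p^n - p^{n₀}`»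
(Washington §13.3, structure of `X/(ν_{n,e}Y_e + pX) ≅ A_n/pA_n`), at finite level and without the structure theory.

§4 (NILPOTENCY-INDEX FORM, the algebra of a successor door).  Same setting; if `(φ - 1)^m M ⊆ ν_j Y + pM` for some
`m < p^j - 1` — i.e. `(σ - 1)^m` kills the layer quotient `M/(ν_j Y + pM)` (`≅ A_{n+j}/p`) — then `ν_j M ⊆ pM` (so again every
`#(M/(ν_k Y + pM)) ≤ #(M/(ν_j Y + pM))`): on `M̄`, `T^m M̄ ⊆ ν̄_jȲ ⊆ T^{c}M̄ ⊆ T^{m+1}M̄` forces `T^mM̄ = T^{m+1}M̄ = ⋯ = 0`.  The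
small-rank lemma is the case `m = dim M/(ν_jY + pM)`; for `p = 3`, `j = 1`, `m = 1` the hypothesis reads «`Gal(K_{n+1}/K_n)` acts
trivially on `Cl(K_{n+1})/3`», with no bound on the rank (`map_le_of_map_sub_one_pow_le`, `card_quotient_le_of_map_sub_one_pow_le`).

References: [Washington1997] L. Washington, *Introduction to Cyclotomic Fields*, 2nd ed., GTM 83, §13.3 Lemmas 13.15, 13.18,
Prop. 13.22–13.23; [Fukuda1994] T. Fukuda, *Remarks on ℤ_p-extensions of number fields*, Proc. Japan Acad. 70 A (1994), Thm. 1
(the finite-level method).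
-/

set_option autoImplicit false

noncomputable section

open Finset Polynomial Module

namespace Literature.NumberTheory.IwasawaTheory.FukudaSmallRank

/-! ## §1 A nilpotent operator with `T^c ≠ 0` has `dim V/T^cV ≥ c` -/

section Nilpotent

variable {F : Type*} [Field F] {V : Type*} [AddCommGroup V] [Module F V] [FiniteDimensional F V]

omit [FiniteDimensional F V] in
/-- If `T^{i+1}V = T^iV` then `T^{i+m}V = T^iV` for every `m`. [folklore] -/
private theorem range_pow_add_eq_of_range_succ_eq (T : V →ₗ[F] V) {i : ℕ}
    (h : LinearMap.range (T ^ (i + 1)) = LinearMap.range (T ^ i)) (m : ℕ) :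
    LinearMap.range (T ^ (i + m)) = LinearMap.range (T ^ i) := by
  induction m with
  | zero => rw [add_zero]
  | succ m ih =>
    have h1 : T ^ (i + (m + 1)) = T * T ^ (i + m) := by rw [← add_assoc, pow_succ']
    have h2 : T ^ (i + 1) = T * T ^ i := pow_succ' T i
    rw [h1, Module.End.mul_eq_comp, LinearMap.range_comp, ih, ← LinearMap.range_comp, ← Module.End.mul_eq_comp,
      ← h2, h]

/-- **`dim T^cV + c ≤ dim V` for a nilpotent `T` with `T^c ≠ 0`**: the chain `V ⊋ TV ⊋ ⋯ ⊋ T^cV` is strict (an equality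
`T^{i+1}V = T^iV` would force `T^iV = T^{i+N}V = 0`). [cite: Washington1997, §13.3 Prop. 13.22 (proof: Nakayama-type chain argument)] -/
theorem finrank_range_pow_add_le (T : V →ₗ[F] V) {N : ℕ} (hN : T ^ N = 0) {c : ℕ} (hc : T ^ c ≠ 0) :
    finrank F (LinearMap.range (T ^ c)) + c ≤ finrank F V := by
  -- by induction on `i ≤ c`
  suffices h : ∀ i, i ≤ c → finrank F (LinearMap.range (T ^ i)) + i ≤ finrank F V from h c le_rfl
  intro i
  induction i with
  | zero =>
    intro _
    rw [pow_zero, Module.End.one_eq_id, LinearMap.range_id, finrank_top, add_zero]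
  | succ i ih =>
    intro hi
    have hi' : i < c := Nat.lt_of_succ_le hi
    have hle : LinearMap.range (T ^ (i + 1)) ≤ LinearMap.range (T ^ i) := by
      rw [pow_succ, Module.End.mul_eq_comp]
      exact LinearMap.range_comp_le_range _ _
    have hne : LinearMap.range (T ^ (i + 1)) ≠ LinearMap.range (T ^ i) := by
      intro heq
      apply hc
      have h0 : LinearMap.range (T ^ (i + N)) = ⊥ := by
        rw [pow_add, hN, mul_zero, LinearMap.range_zero]
      have hi0 : LinearMap.range (T ^ i) = ⊥ := by rw [← range_pow_add_eq_of_range_succ_eq T heq N, h0]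
      have hTi : T ^ i = 0 := LinearMap.range_eq_bot.mp hi0
      rw [show c = (c - i) + i by omega, pow_add, hTi, mul_zero]
    have hlt : LinearMap.range (T ^ (i + 1)) < LinearMap.range (T ^ i) := lt_of_le_of_ne hle hne
    have := Submodule.finrank_lt_finrank_of_lt hlt
    have := ih hi'.le
    omega

end Nilpotent

/-! ## §2 Two polynomial identities in characteristic `p` -/

section CharP

variable {p : ℕ} [Fact p.Prime]

/-- `∑_{i<p^j} (1+X)^i = X^{p^j - 1}` in `𝔽_p[X]` (`X · ∑ (1+X)^i = (1+X)^{p^j} - 1 = X^{p^j}`). [folklore] -/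
private theorem geom_sum_one_add_X (j : ℕ) :
    (∑ i ∈ range (p ^ j), ((1 : (ZMod p)[X]) + X) ^ i) = X ^ (p ^ j - 1) := by
  have hp : p.Prime := Fact.out
  have h := geom_sum_mul ((1 : (ZMod p)[X]) + X) (p ^ j)
  rw [add_sub_cancel_left, add_pow_char_pow, one_pow, add_sub_cancel_left] at h
  have hX : (X : (ZMod p)[X]) ≠ 0 := X_ne_zero
  have hpj : 1 ≤ p ^ j := Nat.one_le_pow _ _ hp.pos
  refine mul_right_cancel₀ hX ?_
  rw [h, ← pow_succ, Nat.sub_add_cancel hpj]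

/-- `∑_{i<p^j} (1+T)^i = T^{p^j - 1}` for `T` in any `𝔽_p`-algebra. [folklore] -/
private theorem geom_sum_one_add_eq_pow {A : Type*} [Ring A] [Algebra (ZMod p) A] (T : A) (j : ℕ) :
    (∑ i ∈ range (p ^ j), (1 + T) ^ i) = T ^ (p ^ j - 1) := by
  have h := congrArg (Polynomial.aeval T) (geom_sum_one_add_X (p := p) j)
  rw [map_sum, map_pow, aeval_X] at h
  simp_rw [map_pow, map_add, map_one, aeval_X] at h
  exact h

/-- `(ψ - 1)^{p^t} = ψ^{p^t} - 1` for `ψ` in any `𝔽_p`-algebra. [folklore] -/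
private theorem sub_one_pow_char_pow {A : Type*} [Ring A] [Algebra (ZMod p) A] (ψ : A) (t : ℕ) :
    (ψ - 1) ^ p ^ t = ψ ^ p ^ t - 1 := by
  have hpoly : ((X : (ZMod p)[X]) - 1) ^ p ^ t = X ^ p ^ t - 1 := by
    rw [sub_pow_char_pow, one_pow]
  have h := congrArg (Polynomial.aeval ψ) hpoly
  rw [map_pow, map_sub, map_sub, map_pow, aeval_X, map_one] at h
  exact h

end CharP

/-! ## §3 The small-rank lemma -/

section Core

variable {p : ℕ} [Fact p.Prime] {N : Type*} [AddCommGroup N] [Module (ZMod p) N] [Finite N]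

/-- **Core (an `𝔽_p`-vector space `N`, written with `ℤ`-linear maps).**  If `φ̄ ∈ End_ℤ(N)` satisfies `φ̄^{p^t} = 1` and
`ν̄_j = ∑_{i<p^j} φ̄^i ≠ 0`, then `#(N/ν̄_j N) ≥ p^{p^j - 1}`: with `T = φ̄ - 1` (nilpotent, `T^{p^t} = 0`) one has `ν̄_j = T^{p^j-1}`
and the chain lemma applies. [cite: Washington1997, §13.3 Lemma 13.18 and Prop. 13.22] -/
theorem pow_le_card_quotient_range_geom_sum (φbar : N →ₗ[ℤ] N) {t : ℕ} (hφ : φbar ^ p ^ t = 1) (j : ℕ)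
    (hne : (∑ i ∈ range (p ^ j), φbar ^ i) ≠ 0) :
    p ^ (p ^ j - 1) ≤ Nat.card (N ⧸ LinearMap.range (∑ i ∈ range (p ^ j), φbar ^ i)) := by
  have hp : p.Prime := Fact.out
  set c : ℕ := p ^ j - 1 with hcdef
  set νbar : N →ₗ[ℤ] N := ∑ i ∈ range (p ^ j), φbar ^ i with hνbar
  -- the same maps, `𝔽_p`-linearly
  set ψ : N →ₗ[ZMod p] N := φbar.toAddMonoidHom.toZModLinearMap p with hψdef
  have hψφ : ∀ x : N, ψ x = φbar x := fun _ => rfl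
  have hψ_pow : ∀ (k : ℕ) (x : N), (ψ ^ k) x = (φbar ^ k) x := by
    intro k
    induction k with
    | zero => intro x; rw [pow_zero, pow_zero, Module.End.one_apply, Module.End.one_apply]
    | succ k ih => intro x; rw [pow_succ, pow_succ, Module.End.mul_apply, Module.End.mul_apply, hψφ, ih]
  have hψt : ψ ^ p ^ t = 1 := by
    refine LinearMap.ext fun x => ?_
    rw [hψ_pow, hφ]
    rfl
  set T : Module.End (ZMod p) N := ψ - 1 with hTdef
  have hTnil : T ^ p ^ t = 0 := by
    rw [hTdef, sub_one_pow_char_pow (p := p) ψ t, hψt, sub_self]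
  have hνT : ∀ x : N, νbar x = (T ^ c) x := by
    intro x
    have h2 : (∑ i ∈ range (p ^ j), ψ ^ i) = T ^ c := by
      rw [hcdef, ← geom_sum_one_add_eq_pow (p := p) T j, hTdef]
      simp_rw [add_sub_cancel]
    rw [← h2, hνbar, LinearMap.sum_apply, LinearMap.sum_apply]
    exact Finset.sum_congr rfl fun i _ => (hψ_pow i x).symm
  have hTc : T ^ c ≠ 0 := by
    intro h0
    apply hne
    refine LinearMap.ext fun x => ?_
    rw [show (∑ i ∈ range (p ^ j), φbar ^ i) x = νbar x from rfl, hνT, h0, LinearMap.zero_apply, LinearMap.zero_apply]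
  have hrank := finrank_range_pow_add_le T hTnil hTc
  have hquot : finrank (ZMod p) (N ⧸ LinearMap.range (T ^ c)) + finrank (ZMod p) (LinearMap.range (T ^ c)) =
      finrank (ZMod p) N := Submodule.finrank_quotient_add_finrank _
  have hcle : c ≤ finrank (ZMod p) (N ⧸ LinearMap.range (T ^ c)) := by omega
  have hcard1 : p ^ c ≤ Nat.card (N ⧸ LinearMap.range (T ^ c)) := by
    rw [Module.natCard_eq_pow_finrank (K := ZMod p), Nat.card_zmod]
    exact Nat.pow_le_pow_right hp.pos hcle
  -- the two ranges have the same elements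
  have hS := Submodule.card_eq_card_quotient_mul_card (LinearMap.range νbar)
  have hR := Submodule.card_eq_card_quotient_mul_card (LinearMap.range (T ^ c))
  have hsub : ((LinearMap.range (T ^ c) : Submodule (ZMod p) N) : Set N) ⊆ LinearMap.range νbar := by
    rintro _ ⟨x, rfl⟩
    exact ⟨x, hνT x⟩
  have hRS : Nat.card (LinearMap.range (T ^ c)) ≤ Nat.card (LinearMap.range νbar) :=
    Nat.card_le_card_of_injective (Set.inclusion hsub) (Set.inclusion_injective hsub)
  have hsub' : ((LinearMap.range νbar : Submodule ℤ N) : Set N) ⊆ LinearMap.range (T ^ c) := by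
    rintro _ ⟨x, rfl⟩
    exact ⟨x, (hνT x).symm⟩
  have hSR : Nat.card (LinearMap.range νbar) ≤ Nat.card (LinearMap.range (T ^ c)) :=
    Nat.card_le_card_of_injective (Set.inclusion hsub') (Set.inclusion_injective hsub')
  have heq : Nat.card (LinearMap.range νbar) = Nat.card (LinearMap.range (T ^ c)) := le_antisymm hSR hRS
  have hpos : 0 < Nat.card (LinearMap.range νbar) := Nat.card_pos
  have h1 : Nat.card (LinearMap.range νbar) * Nat.card (N ⧸ LinearMap.range (T ^ c)) =
      Nat.card (LinearMap.range νbar) * Nat.card (N ⧸ LinearMap.range νbar) := by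
    rw [← hS]
    nth_rewrite 1 [heq]
    rw [← hR]
  have h2 : Nat.card (N ⧸ LinearMap.range (T ^ c)) = Nat.card (N ⧸ LinearMap.range νbar) :=
    Nat.eq_of_mul_eq_mul_left hpos h1
  rw [← h2]
  exact hcard1

end Core

section SmallRank

variable {p : ℕ} [Fact p.Prime] {M : Type*} [AddCommGroup M] [Finite M]

/-- Cardinality monotonicity of quotients: for `ℤ`-submodules `S ⊆ R` of a finite module, `#(M/R) ≤ #(M/S)`. [folklore] -/
private theorem card_quotient_le_of_le {N : Type*} [AddCommGroup N] [Finite N] {S R : Submodule ℤ N} (h : S ≤ R) :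
    Nat.card (N ⧸ R) ≤ Nat.card (N ⧸ S) := by
  have hS := Submodule.card_eq_card_quotient_mul_card S
  have hR := Submodule.card_eq_card_quotient_mul_card R
  have hSR : Nat.card S ≤ Nat.card R :=
    Nat.card_le_card_of_injective (Submodule.inclusion h) (Submodule.inclusion_injective h)
  have hSpos : 0 < Nat.card S := Nat.card_pos
  have h1 : Nat.card S * Nat.card (N ⧸ R) ≤ Nat.card S * Nat.card (N ⧸ S) := by
    calc Nat.card S * Nat.card (N ⧸ R) ≤ Nat.card R * Nat.card (N ⧸ R) := Nat.mul_le_mul_right _ hSR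
      _ = Nat.card N := hR.symm
      _ = Nat.card S * Nat.card (N ⧸ S) := hS
  exact Nat.le_of_mul_le_mul_left h1 hSpos

/-- **The small-rank lemma.**  `M` a finite abelian group, `φ ∈ End_ℤ(M)` with `φ^{p^t} = 1`, `Y ≤ M`,
`ν_j = ∑_{i<p^j} φ^i`, `pM` = the image of multiplication by `p`: if `#(M/(ν_j Y + pM)) < p^{p^j - 1}` then `ν_j Y ⊆ pM`.
(On `M̄ = M/pM`: `T = φ̄ - 1` is nilpotent, `ν̄_j = T^{p^j-1}`, and `dim M̄/T^cM̄ ≥ c` unless `T^c = 0`.)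
[cite: Washington1997, §13.3 Lemma 13.18 and Prop. 13.22] [cite: Fukuda1994, Thm. 1 (proof, p. 264)] -/
theorem map_geom_sum_le_of_card_quotient_lt (φ : Module.End ℤ M) {t : ℕ} (hφ : φ ^ p ^ t = 1) (Y : Submodule ℤ M)
    (j : ℕ)
    (hlt : Nat.card (M ⧸ (Y.map (∑ i ∈ range (p ^ j), φ ^ i) ⊔
        (⊤ : Submodule ℤ M).map ((p : ℤ) • (1 : Module.End ℤ M)))) < p ^ (p ^ j - 1)) :
    Y.map (∑ i ∈ range (p ^ j), φ ^ i) ≤ (⊤ : Submodule ℤ M).map ((p : ℤ) • (1 : Module.End ℤ M)) := by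
  have hp : p.Prime := Fact.out
  set P : Submodule ℤ M := (⊤ : Submodule ℤ M).map ((p : ℤ) • (1 : Module.End ℤ M)) with hPdef
  set ν : Module.End ℤ M := ∑ i ∈ range (p ^ j), φ ^ i with hνdef
  set c : ℕ := p ^ j - 1 with hcdef
  have hmemP : ∀ m : M, (p : ℤ) • m ∈ P := fun m =>
    Submodule.mem_map.mpr ⟨m, Submodule.mem_top, by rw [LinearMap.smul_apply, Module.End.one_apply]⟩
  have hPφ : P ≤ P.comap φ := by
    intro x hx
    obtain ⟨m, -, rfl⟩ := Submodule.mem_map.mp hx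
    rw [Submodule.mem_comap, LinearMap.smul_apply, Module.End.one_apply, map_zsmul]
    exact hmemP _
  -- the `𝔽_p`-vector space `M̄ = M/pM`
  have hpQ : ∀ x : M ⧸ P, p • x = 0 := by
    intro x
    induction x using Submodule.Quotient.induction_on with
    | H m =>
      have hm : (p • m : M) ∈ P := by rw [← natCast_zsmul]; exact hmemP m
      have h := map_nsmul P.mkQ p m
      rw [Submodule.mkQ_apply, Submodule.mkQ_apply] at h
      rw [← h]
      exact (Submodule.Quotient.mk_eq_zero P).mpr hm
  haveI : Module (ZMod p) (M ⧸ P) := AddCommGroup.zmodModule hpQ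
  haveI : Finite (M ⧸ P) := Finite.of_surjective _ (Submodule.Quotient.mk_surjective P)
  -- `φ̄` on `M̄`, `φ̄^{p^t} = 1`
  set φbar : (M ⧸ P) →ₗ[ℤ] (M ⧸ P) := P.mapQ P φ hPφ with hφbar
  have hφbar_mk : ∀ m : M, φbar (Submodule.Quotient.mk m) = Submodule.Quotient.mk (φ m) := fun m =>
    Submodule.mapQ_apply P P φ m
  have hφbar_pow_mk : ∀ (k : ℕ) (m : M), (φbar ^ k) (Submodule.Quotient.mk m) = Submodule.Quotient.mk ((φ ^ k) m) := by
    intro k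
    induction k with
    | zero => intro m; rw [pow_zero, pow_zero, Module.End.one_apply, Module.End.one_apply]
    | succ k ih => intro m; rw [pow_succ, pow_succ, Module.End.mul_apply, Module.End.mul_apply, hφbar_mk, ih]
  have hφbart : φbar ^ p ^ t = 1 := by
    refine LinearMap.ext fun x => ?_
    induction x using Submodule.Quotient.induction_on with
    | H m => rw [hφbar_pow_mk, hφ, Module.End.one_apply, Module.End.one_apply]
  set νbar : (M ⧸ P) →ₗ[ℤ] (M ⧸ P) := ∑ i ∈ range (p ^ j), φbar ^ i with hνbar
  have hν_mk : ∀ m : M, Submodule.Quotient.mk (p := P) (ν m) = νbar (Submodule.Quotient.mk m) := by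
    intro m
    rw [hνdef, hνbar, LinearMap.sum_apply, LinearMap.sum_apply]
    rw [show (Submodule.Quotient.mk (p := P) (∑ i ∈ range (p ^ j), (φ ^ i) m)) =
      ∑ i ∈ range (p ^ j), Submodule.Quotient.mk (p := P) ((φ ^ i) m) from map_sum (P.mkQ) _ _]
    exact Finset.sum_congr rfl fun i _ => (hφbar_pow_mk i m).symm
  -- if `ν Y ⊄ pM` then `ν̄ ≠ 0`, so `#(M̄/ν̄ M̄) ≥ p^c`
  by_contra hnot
  obtain ⟨x, hx, hxP⟩ : ∃ x ∈ Y.map ν, x ∉ P := Set.not_subset.mp hnot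
  obtain ⟨y, hy, rfl⟩ := Submodule.mem_map.mp hx
  have hne : νbar ≠ 0 := by
    intro h0
    apply hxP
    rw [← Submodule.Quotient.mk_eq_zero P, hν_mk, h0, LinearMap.zero_apply]
  have hcard1 : p ^ c ≤ Nat.card ((M ⧸ P) ⧸ LinearMap.range νbar) :=
    pow_le_card_quotient_range_geom_sum φbar hφbart j hne
  -- `#(M/(νY + pM)) = #(M̄ / \overline{νY})` and `\overline{νY} ⊆ ν̄ M̄`
  set S : Submodule ℤ M := Y.map ν ⊔ P with hSdef
  have hPS : P ≤ S := le_sup_right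
  have hcard2 : Nat.card (M ⧸ S) = Nat.card ((M ⧸ P) ⧸ S.map P.mkQ) :=
    (Nat.card_congr (Submodule.quotientQuotientEquivQuotient P S hPS).toEquiv).symm
  have hsub : S.map P.mkQ ≤ LinearMap.range νbar := by
    rintro _ ⟨s, hs, rfl⟩
    obtain ⟨a, ha, b, hb, rfl⟩ := Submodule.mem_sup.mp hs
    obtain ⟨y', -, rfl⟩ := Submodule.mem_map.mp ha
    rw [Submodule.mkQ_apply, Submodule.Quotient.mk_add, (Submodule.Quotient.mk_eq_zero P).mpr hb, add_zero, hν_mk]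
    exact LinearMap.mem_range_self _ _
  have hcard3 : Nat.card ((M ⧸ P) ⧸ LinearMap.range νbar) ≤ Nat.card ((M ⧸ P) ⧸ S.map P.mkQ) :=
    card_quotient_le_of_le hsub
  have : p ^ c ≤ Nat.card (M ⧸ S) := by rw [hcard2]; exact hcard1.trans hcard3
  exact absurd (lt_of_le_of_lt this hlt) (lt_irrefl _)

/-- **Consequence: the quotient by `ν_k Y + pM` is then no larger, for EVERY `k`** (`ν_j Y ⊆ pM` makes `ν_j Y + pM = pM` the smallest
of all the `ν_k Y + pM`). [cite: Washington1997, §13.3 Lemma 13.18 and Prop. 13.22] -/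
theorem card_quotient_le_of_card_quotient_lt (φ : Module.End ℤ M) {t : ℕ} (hφ : φ ^ p ^ t = 1) (Y : Submodule ℤ M)
    (j : ℕ)
    (hlt : Nat.card (M ⧸ (Y.map (∑ i ∈ range (p ^ j), φ ^ i) ⊔
        (⊤ : Submodule ℤ M).map ((p : ℤ) • (1 : Module.End ℤ M)))) < p ^ (p ^ j - 1)) (k : ℕ) :
    Nat.card (M ⧸ (Y.map (∑ i ∈ range (p ^ k), φ ^ i) ⊔ (⊤ : Submodule ℤ M).map ((p : ℤ) • (1 : Module.End ℤ M)))) ≤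
      Nat.card (M ⧸ (Y.map (∑ i ∈ range (p ^ j), φ ^ i) ⊔
        (⊤ : Submodule ℤ M).map ((p : ℤ) • (1 : Module.End ℤ M)))) := by
  set P : Submodule ℤ M := (⊤ : Submodule ℤ M).map ((p : ℤ) • (1 : Module.End ℤ M)) with hPdef
  have hle := map_geom_sum_le_of_card_quotient_lt φ hφ Y j hlt
  have heq : Y.map (∑ i ∈ range (p ^ j), φ ^ i) ⊔ P = P := sup_eq_right.mpr hle
  rw [heq]
  have hS := Submodule.card_eq_card_quotient_mul_card (Y.map (∑ i ∈ range (p ^ k), φ ^ i) ⊔ P)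
  have hR := Submodule.card_eq_card_quotient_mul_card P
  have hPR : Nat.card P ≤ Nat.card ↥(Y.map (∑ i ∈ range (p ^ k), φ ^ i) ⊔ P) :=
    Nat.card_le_card_of_injective (Submodule.inclusion (le_sup_right : P ≤ Y.map (∑ i ∈ range (p ^ k), φ ^ i) ⊔ P))
      (Submodule.inclusion_injective _)
  have hpos : 0 < Nat.card P := Nat.card_pos
  have h1 : Nat.card P * Nat.card (M ⧸ (Y.map (∑ i ∈ range (p ^ k), φ ^ i) ⊔ P)) ≤ Nat.card P * Nat.card (M ⧸ P) := by
    calc Nat.card P * Nat.card (M ⧸ (Y.map (∑ i ∈ range (p ^ k), φ ^ i) ⊔ P))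
        ≤ Nat.card ↥(Y.map (∑ i ∈ range (p ^ k), φ ^ i) ⊔ P) * Nat.card (M ⧸ (Y.map (∑ i ∈ range (p ^ k), φ ^ i) ⊔ P)) :=
          Nat.mul_le_mul_right _ hPR
      _ = Nat.card M := hS.symm
      _ = Nat.card P * Nat.card (M ⧸ P) := hR
  exact Nat.le_of_mul_le_mul_left h1 hpos

end SmallRank

/-! ## §4 Nilpotency-index form: `(φ - 1)^m M ⊆ ν_j Y + pM` with `m < p^j - 1` forces `ν_j M ⊆ pM` -/

section NilpotencyCore

variable {p : ℕ} [Fact p.Prime] {N : Type*} [AddCommGroup N] [Module (ZMod p) N] [Finite N]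

omit [Finite N] in
/-- **Core, nilpotency-index form (an `𝔽_p`-vector space `N`, `ℤ`-linear maps).**  If `φ̄^{p^t} = 1`, `m < p^j - 1` and
`(φ̄ - 1)^m N ⊆ ν̄_j N` (`ν̄_j = ∑_{i<p^j} φ̄^i`), then `ν̄_j = 0`: with `T = φ̄ - 1` (nilpotent) and `ν̄_j = T^{p^j-1}`,
`T^m N ⊆ T^{p^j-1} N ⊆ T^{m+1} N` makes the chain `T^m N ⊇ T^{m+1} N ⊇ ⋯` stationary from `m`, so `T^m = 0` and `T^{p^j-1} = 0`.
[cite: Washington1997, §13.3 Lemma 13.18 and Prop. 13.22] [cite: Lang1990, Ch. 13 §1 Lemma 3] -/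
theorem geom_sum_eq_zero_of_range_sub_one_pow_le (φbar : N →ₗ[ℤ] N) {t : ℕ} (hφ : φbar ^ p ^ t = 1) (j : ℕ) {m : ℕ}
    (hm : m < p ^ j - 1)
    (hle : LinearMap.range ((φbar - 1) ^ m) ≤ LinearMap.range (∑ i ∈ range (p ^ j), φbar ^ i)) :
    (∑ i ∈ range (p ^ j), φbar ^ i) = 0 := by
  set c : ℕ := p ^ j - 1 with hcdef
  set νbar : N →ₗ[ℤ] N := ∑ i ∈ range (p ^ j), φbar ^ i with hνbar
  -- the same maps, `𝔽_p`-linearly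
  set ψ : N →ₗ[ZMod p] N := φbar.toAddMonoidHom.toZModLinearMap p with hψdef
  have hψφ : ∀ x : N, ψ x = φbar x := fun _ => rfl
  have hψ_pow : ∀ (k : ℕ) (x : N), (ψ ^ k) x = (φbar ^ k) x := by
    intro k
    induction k with
    | zero => intro x; rw [pow_zero, pow_zero, Module.End.one_apply, Module.End.one_apply]
    | succ k ih => intro x; rw [pow_succ, pow_succ, Module.End.mul_apply, Module.End.mul_apply, hψφ, ih]
  have hψt : ψ ^ p ^ t = 1 := by
    refine LinearMap.ext fun x => ?_
    rw [hψ_pow, hφ]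
    rfl
  set T : Module.End (ZMod p) N := ψ - 1 with hTdef
  have hTnil : T ^ p ^ t = 0 := by
    rw [hTdef, sub_one_pow_char_pow (p := p) ψ t, hψt, sub_self]
  have hνT : ∀ x : N, νbar x = (T ^ c) x := by
    intro x
    have h2 : (∑ i ∈ range (p ^ j), ψ ^ i) = T ^ c := by
      rw [hcdef, ← geom_sum_one_add_eq_pow (p := p) T j, hTdef]
      simp_rw [add_sub_cancel]
    rw [← h2, hνbar, LinearMap.sum_apply, LinearMap.sum_apply]
    exact Finset.sum_congr rfl fun i _ => (hψ_pow i x).symm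
  have hTx : ∀ x : N, T x = (φbar - 1) x := fun x => by
    rw [hTdef, LinearMap.sub_apply, LinearMap.sub_apply, Module.End.one_apply, Module.End.one_apply, hψφ]
  have hT_pow : ∀ (k : ℕ) (x : N), (T ^ k) x = ((φbar - 1) ^ k) x := by
    intro k
    induction k with
    | zero => intro x; rw [pow_zero, pow_zero, Module.End.one_apply, Module.End.one_apply]
    | succ k ih => intro x; rw [pow_succ, pow_succ, Module.End.mul_apply, Module.End.mul_apply, hTx, ih]
  -- `T^m N ⊆ T^{m+1} N`
  have hincl : LinearMap.range (T ^ m) ≤ LinearMap.range (T ^ (m + 1)) := by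
    rintro _ ⟨x, rfl⟩
    have hx : ((φbar - 1) ^ m) x ∈ LinearMap.range νbar := hle (LinearMap.mem_range_self _ x)
    obtain ⟨y, hy⟩ := hx
    refine ⟨(T ^ (c - (m + 1))) y, ?_⟩
    rw [← Module.End.mul_apply, ← pow_add, show m + 1 + (c - (m + 1)) = c by omega, ← hνT, hy, hT_pow]
  have hdecr : LinearMap.range (T ^ (m + 1)) ≤ LinearMap.range (T ^ m) := by
    rw [pow_succ, Module.End.mul_eq_comp, LinearMap.range_comp]
    exact LinearMap.map_le_range
  have heq : LinearMap.range (T ^ (m + 1)) = LinearMap.range (T ^ m) := le_antisymm hdecr hincl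
  have hzero : LinearMap.range (T ^ m) = ⊥ := by
    have h := range_pow_add_eq_of_range_succ_eq T heq (p ^ t)
    rw [pow_add, hTnil, mul_zero, LinearMap.range_zero] at h
    exact h.symm
  have hTm : T ^ m = 0 := LinearMap.range_eq_bot.mp hzero
  have hTc : T ^ c = 0 := by
    rw [show c = m + (c - m) by omega, pow_add, hTm, zero_mul]
  refine LinearMap.ext fun x => ?_
  rw [show (∑ i ∈ range (p ^ j), φbar ^ i) x = νbar x from rfl, hνT, hTc, LinearMap.zero_apply, LinearMap.zero_apply]

end NilpotencyCore

section NilpotencyIndex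

variable {p : ℕ} [Fact p.Prime] {M : Type*} [AddCommGroup M] [Finite M]

omit [Finite M] in
/-- **The nilpotency-index lemma.**  `M` a finite abelian group, `φ ∈ End(M)` with `φ^{p^t} = 1`, `Y ≤ M`, `ν_j = ∑_{i<p^j} φ^i`,
`pM` the multiples of `p`.  If `(φ - 1)^m M ⊆ ν_j Y + pM` for some `m < p^j - 1` (the generator `σ ↦ φ` of the layer group acts
on `M/(ν_jY + pM)` with `(σ - 1)^m = 0`; `m = 1`: trivially), then `ν_j M ⊆ pM` — in particular `ν_j Y ⊆ pM`, the conclusion of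
the small-rank lemma, with NO bound on `#(M/(ν_jY + pM))`. [cite: Washington1997, §13.3 Lemma 13.18 and Prop. 13.22]
[cite: Lang1990, Ch. 13 §1 Lemma 3] -/
theorem map_le_of_map_sub_one_pow_le (φ : Module.End ℤ M) {t : ℕ} (hφ : φ ^ p ^ t = 1) (Y : Submodule ℤ M) (j : ℕ)
    {m : ℕ} (hm : m < p ^ j - 1)
    (hle : (⊤ : Submodule ℤ M).map ((φ - 1) ^ m) ≤
      Y.map (∑ i ∈ range (p ^ j), φ ^ i) ⊔ (⊤ : Submodule ℤ M).map ((p : ℤ) • (1 : Module.End ℤ M))) :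
    (⊤ : Submodule ℤ M).map (∑ i ∈ range (p ^ j), φ ^ i) ≤ (⊤ : Submodule ℤ M).map ((p : ℤ) • (1 : Module.End ℤ M)) := by
  set P : Submodule ℤ M := (⊤ : Submodule ℤ M).map ((p : ℤ) • (1 : Module.End ℤ M)) with hPdef
  set ν : Module.End ℤ M := ∑ i ∈ range (p ^ j), φ ^ i with hνdef
  have hmemP : ∀ m : M, (p : ℤ) • m ∈ P := fun m =>
    Submodule.mem_map.mpr ⟨m, Submodule.mem_top, by rw [LinearMap.smul_apply, Module.End.one_apply]⟩
  have hPφ : P ≤ P.comap φ := by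
    intro x hx
    obtain ⟨m, -, rfl⟩ := Submodule.mem_map.mp hx
    rw [Submodule.mem_comap, LinearMap.smul_apply, Module.End.one_apply, map_zsmul]
    exact hmemP _
  -- the `𝔽_p`-vector space `M̄ = M/pM`
  have hpQ : ∀ x : M ⧸ P, p • x = 0 := by
    intro x
    induction x using Submodule.Quotient.induction_on with
    | H m =>
      have hm : (p • m : M) ∈ P := by rw [← natCast_zsmul]; exact hmemP m
      have h := map_nsmul P.mkQ p m
      rw [Submodule.mkQ_apply, Submodule.mkQ_apply] at h
      rw [← h]
      exact (Submodule.Quotient.mk_eq_zero P).mpr hm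
  haveI : Module (ZMod p) (M ⧸ P) := AddCommGroup.zmodModule hpQ
  -- `φ̄` on `M̄`, `φ̄^{p^t} = 1`
  set φbar : (M ⧸ P) →ₗ[ℤ] (M ⧸ P) := P.mapQ P φ hPφ with hφbar
  have hφbar_mk : ∀ m : M, φbar (Submodule.Quotient.mk m) = Submodule.Quotient.mk (φ m) := fun m =>
    Submodule.mapQ_apply P P φ m
  have hφbar_pow_mk : ∀ (k : ℕ) (m : M), (φbar ^ k) (Submodule.Quotient.mk m) = Submodule.Quotient.mk ((φ ^ k) m) := by
    intro k
    induction k with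
    | zero => intro m; rw [pow_zero, pow_zero, Module.End.one_apply, Module.End.one_apply]
    | succ k ih => intro m; rw [pow_succ, pow_succ, Module.End.mul_apply, Module.End.mul_apply, hφbar_mk, ih]
  have hφbart : φbar ^ p ^ t = 1 := by
    refine LinearMap.ext fun x => ?_
    induction x using Submodule.Quotient.induction_on with
    | H m => rw [hφbar_pow_mk, hφ, Module.End.one_apply, Module.End.one_apply]
  have hφbar_sub_mk : ∀ x : M, (φbar - 1) (Submodule.Quotient.mk x) = Submodule.Quotient.mk ((φ - 1) x) := fun x => by
    rw [LinearMap.sub_apply, LinearMap.sub_apply, Module.End.one_apply, Module.End.one_apply, hφbar_mk,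
      Submodule.Quotient.mk_sub]
  have hφbar_sub_pow_mk : ∀ (k : ℕ) (x : M),
      ((φbar - 1) ^ k) (Submodule.Quotient.mk x) = Submodule.Quotient.mk (((φ - 1) ^ k) x) := by
    intro k
    induction k with
    | zero => intro x; rw [pow_zero, pow_zero, Module.End.one_apply, Module.End.one_apply]
    | succ k ih => intro x; rw [pow_succ, pow_succ, Module.End.mul_apply, Module.End.mul_apply, hφbar_sub_mk, ih]
  set νbar : (M ⧸ P) →ₗ[ℤ] (M ⧸ P) := ∑ i ∈ range (p ^ j), φbar ^ i with hνbar
  have hν_mk : ∀ m : M, Submodule.Quotient.mk (p := P) (ν m) = νbar (Submodule.Quotient.mk m) := by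
    intro m
    rw [hνdef, hνbar, LinearMap.sum_apply, LinearMap.sum_apply]
    rw [show (Submodule.Quotient.mk (p := P) (∑ i ∈ range (p ^ j), (φ ^ i) m)) =
      ∑ i ∈ range (p ^ j), Submodule.Quotient.mk (p := P) ((φ ^ i) m) from map_sum (P.mkQ) _ _]
    exact Finset.sum_congr rfl fun i _ => (hφbar_pow_mk i m).symm
  -- `(φ̄ - 1)^m M̄ ⊆ ν̄ M̄`
  have hrange : LinearMap.range ((φbar - 1) ^ m) ≤ LinearMap.range νbar := by
    rintro _ ⟨z, rfl⟩
    induction z using Submodule.Quotient.induction_on with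
    | H x =>
      rw [hφbar_sub_pow_mk]
      have hx : ((φ - 1) ^ m) x ∈ Y.map ν ⊔ P := hle (Submodule.mem_map_of_mem Submodule.mem_top)
      obtain ⟨a, ha, b, hb, hab⟩ := Submodule.mem_sup.mp hx
      obtain ⟨y', -, rfl⟩ := Submodule.mem_map.mp ha
      rw [← hab, Submodule.Quotient.mk_add, (Submodule.Quotient.mk_eq_zero P).mpr hb, add_zero, hν_mk]
      exact LinearMap.mem_range_self _ _
  have hν0 : νbar = 0 := geom_sum_eq_zero_of_range_sub_one_pow_le φbar hφbart j hm hrange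
  -- hence `ν M ⊆ pM`
  rintro _ ⟨x, -, rfl⟩
  rw [← Submodule.Quotient.mk_eq_zero P, hν_mk, hν0, LinearMap.zero_apply]

omit [Finite M] in
/-- Under the nilpotency-index hypothesis, `ν_j Y ⊆ pM` (the conclusion of the small-rank lemma).
[cite: Washington1997, §13.3 Lemma 13.18 and Prop. 13.22] -/
theorem map_geom_sum_le_of_map_sub_one_pow_le (φ : Module.End ℤ M) {t : ℕ} (hφ : φ ^ p ^ t = 1) (Y : Submodule ℤ M)
    (j : ℕ) {m : ℕ} (hm : m < p ^ j - 1)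
    (hle : (⊤ : Submodule ℤ M).map ((φ - 1) ^ m) ≤
      Y.map (∑ i ∈ range (p ^ j), φ ^ i) ⊔ (⊤ : Submodule ℤ M).map ((p : ℤ) • (1 : Module.End ℤ M))) :
    Y.map (∑ i ∈ range (p ^ j), φ ^ i) ≤ (⊤ : Submodule ℤ M).map ((p : ℤ) • (1 : Module.End ℤ M)) :=
  (Submodule.map_mono le_top).trans (map_le_of_map_sub_one_pow_le φ hφ Y j hm hle)

/-- **Consequence, nilpotency-index form: `#(M/(ν_k Y + pM)) ≤ #(M/(ν_j Y + pM))` for EVERY `k`.**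
[cite: Washington1997, §13.3 Lemma 13.18 and Prop. 13.22] [cite: Lang1990, Ch. 13 §1 Lemma 3] -/
theorem card_quotient_le_of_map_sub_one_pow_le (φ : Module.End ℤ M) {t : ℕ} (hφ : φ ^ p ^ t = 1) (Y : Submodule ℤ M)
    (j : ℕ) {m : ℕ} (hm : m < p ^ j - 1)
    (hle : (⊤ : Submodule ℤ M).map ((φ - 1) ^ m) ≤
      Y.map (∑ i ∈ range (p ^ j), φ ^ i) ⊔ (⊤ : Submodule ℤ M).map ((p : ℤ) • (1 : Module.End ℤ M))) (k : ℕ) :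
    Nat.card (M ⧸ (Y.map (∑ i ∈ range (p ^ k), φ ^ i) ⊔ (⊤ : Submodule ℤ M).map ((p : ℤ) • (1 : Module.End ℤ M)))) ≤
      Nat.card (M ⧸ (Y.map (∑ i ∈ range (p ^ j), φ ^ i) ⊔
        (⊤ : Submodule ℤ M).map ((p : ℤ) • (1 : Module.End ℤ M)))) := by
  set P : Submodule ℤ M := (⊤ : Submodule ℤ M).map ((p : ℤ) • (1 : Module.End ℤ M)) with hPdef
  have hle' := map_geom_sum_le_of_map_sub_one_pow_le φ hφ Y j hm hle
  have heq : Y.map (∑ i ∈ range (p ^ j), φ ^ i) ⊔ P = P := sup_eq_right.mpr hle'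
  rw [heq]
  have hS := Submodule.card_eq_card_quotient_mul_card (Y.map (∑ i ∈ range (p ^ k), φ ^ i) ⊔ P)
  have hR := Submodule.card_eq_card_quotient_mul_card P
  have hPR : Nat.card P ≤ Nat.card ↥(Y.map (∑ i ∈ range (p ^ k), φ ^ i) ⊔ P) :=
    Nat.card_le_card_of_injective (Submodule.inclusion (le_sup_right : P ≤ Y.map (∑ i ∈ range (p ^ k), φ ^ i) ⊔ P))
      (Submodule.inclusion_injective _)
  have hpos : 0 < Nat.card P := Nat.card_pos
  have h1 : Nat.card P * Nat.card (M ⧸ (Y.map (∑ i ∈ range (p ^ k), φ ^ i) ⊔ P)) ≤ Nat.card P * Nat.card (M ⧸ P) := by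
    calc Nat.card P * Nat.card (M ⧸ (Y.map (∑ i ∈ range (p ^ k), φ ^ i) ⊔ P))
        ≤ Nat.card ↥(Y.map (∑ i ∈ range (p ^ k), φ ^ i) ⊔ P) * Nat.card (M ⧸ (Y.map (∑ i ∈ range (p ^ k), φ ^ i) ⊔ P)) :=
          Nat.mul_le_mul_right _ hPR
      _ = Nat.card M := hS.symm
      _ = Nat.card P * Nat.card (M ⧸ P) := hR
  exact Nat.le_of_mul_le_mul_left h1 hpos

end NilpotencyIndex

end Literature.NumberTheory.IwasawaTheory.FukudaSmallRank

end
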